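import Literature.NumberTheory.PAdicHodge.DeRhamInductionDescent
import Literature.NumberTheory.GaloisRepresentations.LabelledWeightsFramedBlockSum
import HarnessLib

/-!
# `ρ₁ ⊞ ρ₂` is de Rham iff `ρ₁` and `ρ₂` are — summands of arbitrary sizes
# (Fontaine, Astérisque 223, Exp. III Prop. 1.5.2: direct sums AND direct summands)

Topic `NumberTheory/PAdicHodge`.  PROOF FILE (theorems only: no definition, no named fact, no
instance; D-0026).  The general-size form of `FramedRep.isDeRhamWith_blockSum_iff` (file
`DeRhamBlockSum`, equal sizes, through the block-diagonal lemmas): for continuous framed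
`ρ₁ : Γ_F → GL_m(ℚ̄_ℓ)`, `ρ₂ : Γ_F → GL_n(ℚ̄_ℓ)`,

  `(ρ₁ ⊞ ρ₂).IsDeRhamWith alg 𝔅 ↔ ρ₁.IsDeRhamWith alg 𝔅 ∧ ρ₂.IsDeRhamWith alg 𝔅`.

1. `PeriodRingData.finrank_D_add_le_finrank_D_prod`, `PeriodRingData.isAdmissible_prod_iff` — for
   any period-ring datum, `dim D(V₁) + dim D(V₂) ≤ dim D(V₁ × V₂)` (the maps `D(ι₁) + D(ι₂)` with
   left inverse `(D(π₁), D(π₂))`, functoriality `exists_DMap`), whence with Fontaine's inequality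
   and the accepted `isAdmissible_of_shortExact` (`0 → V₁ → V₁ × V₂ → V₂ → 0`):
   `V₁ × V₂` is admissible iff `V₁` and `V₂` are.
2. `PeriodRingData.isAdmissible_restrictScalars_blockSum_iff` — framed form over a finite
   `E' ⊆ ℚ̄_p`: the `ℚ_p`-restriction of `S₁ ⊞ S₂` is admissible iff those of `S₁`, `S₂` are
   (`E'^m × E'^n ≅ E'^{m+n}` as `ℚ_p[Γ]`-modules).
3. `FramedRep.isDeRhamWith_blockSum_iff'` — over `ℚ̄_ℓ`, by descent of frames of finite models
   (`exists_conj_baseChange_eq_of_hasQlModel`, `FramedRep.exists_baseChange_eq`,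
   `FramedRep.baseChange_blockSum`, `isAdmissible_restrictScalars_conj_iff`,
   `isAdmissible_restrictScalars_baseChange_iff`); `PstWeilDeligneData.isDeRhamFramed_blockSum_iff'`;
   and for a number field and THE pinned Fontaine data `isDeRhamFramed_toLocal_blockSum_iff'`.

## References

* [FontaineAsterisque223III] J.-M. Fontaine, *Représentations p-adiques semi-stables*, Astérisque
  223 (1994), Exp. III §1.5, Prop. 1.5.2; Prop. 1.4.2 (Fontaine's inequality).
* [BrinonConrad2009] O. Brinon, B. Conrad, *CMI Summer School notes on p-adic Hodge theory*
  (2009), Thm. 5.2.1.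
* [BuzzardGeeLMS2014] K. Buzzard, T. Gee, *The conjectural connections between automorphic
  representations and Galois representations* (2014), §2.2 (finite coefficient fields).
-/

noncomputable section

open scoped NumberField TensorProduct
open Field TensorProduct Literature.NumberTheory.GaloisRepresentations

namespace Literature.NumberTheory.GaloisRepresentations

open Literature.NumberTheory.PAdicHodge

namespace PeriodRingData

/-! ## §1 `D(V₁ × V₂) ⊇ D(V₁) ⊕ D(V₂)`; products are admissible iff the factors are -/

section Prod

set_option maxSynthPendingDepth 3

universe u v v' w w'

variable {Γ : Type u} [Group Γ] [TopologicalSpace Γ] {P : Type v} {E : Type v'} [Field P]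
  [TopologicalSpace P] [Field E] [Algebra P E]
  (𝔅 : PeriodRingData.{u, v, v', w} Γ P E)
  {M₁ : Type w'} [AddCommGroup M₁] [Module P M₁] [TopologicalSpace M₁]
  {M₂ : Type w'} [AddCommGroup M₂] [Module P M₂] [TopologicalSpace M₂]
  (ρ : ContinuousRep Γ P (M₁ × M₂)) (ρ₁ : ContinuousRep Γ P M₁) (ρ₂ : ContinuousRep Γ P M₂)

omit [TopologicalSpace Γ] [TopologicalSpace P] [TopologicalSpace M₁] [TopologicalSpace M₂] in
/-- `1 ⊗ 0 = 0` on `B ⊗_P V₁ → B ⊗_P V₂`. [folklore] -/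
private theorem algebraTensorModule_map_id_zero (x : 𝔅.B ⊗[P] M₁) :
    AlgebraTensorModule.map (LinearMap.id : 𝔅.B →ₗ[E] 𝔅.B) (0 : M₁ →ₗ[P] M₂) x = 0 := by
  induction x using TensorProduct.induction_on with
  | zero => simp
  | tmul b m => simp
  | add x y hx hy => rw [map_add, hx, hy, add_zero]

/-- **`dim_E D(V₁) + dim_E D(V₂) ≤ dim_E D(V₁ × V₂)`** for a representation acting componentwise
on `V₁ × V₂`: the `E`-linear map `D(V₁) × D(V₂) → D(V₁ × V₂)`, `(x, y) ↦ D(ι₁) x + D(ι₂) y`, has the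
left inverse `z ↦ (D(π₁) z, D(π₂) z)` (functoriality of `D`, `exists_DMap`).
[cite: FontaineAsterisque223III, Exp. III §1.5, Prop. 1.5.2] -/
theorem finrank_D_add_le_finrank_D_prod [FiniteDimensional P M₁] [FiniteDimensional P M₂]
    (h : ∀ (σ : Γ) (x : M₁ × M₂), ρ σ x = (ρ₁ σ x.1, ρ₂ σ x.2)) :
    Module.finrank E (𝔅.D ρ₁) + Module.finrank E (𝔅.D ρ₂) ≤ Module.finrank E (𝔅.D ρ) := by
  haveI : Module.Finite E (𝔅.D ρ) := 𝔅.finite_D ρ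
  haveI : Module.Finite E (𝔅.D ρ₁) := 𝔅.finite_D ρ₁
  haveI : Module.Finite E (𝔅.D ρ₂) := 𝔅.finite_D ρ₂
  have hι₁ : ∀ (σ : Γ) (x : M₁), LinearMap.inl P M₁ M₂ (ρ₁ σ x) = ρ σ (LinearMap.inl P M₁ M₂ x) :=
    fun σ x => by rw [h]; simp
  have hι₂ : ∀ (σ : Γ) (x : M₂), LinearMap.inr P M₁ M₂ (ρ₂ σ x) = ρ σ (LinearMap.inr P M₁ M₂ x) :=
    fun σ x => by rw [h]; simp
  have hπ₁ : ∀ (σ : Γ) (x : M₁ × M₂), LinearMap.fst P M₁ M₂ (ρ σ x) = ρ₁ σ (LinearMap.fst P M₁ M₂ x) :=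
    fun σ x => by rw [h]; rfl
  have hπ₂ : ∀ (σ : Γ) (x : M₁ × M₂), LinearMap.snd P M₁ M₂ (ρ σ x) = ρ₂ σ (LinearMap.snd P M₁ M₂ x) :=
    fun σ x => by rw [h]; rfl
  obtain ⟨F₁, hF₁⟩ := 𝔅.exists_DMap ρ₁ ρ (LinearMap.inl P M₁ M₂) hι₁
  obtain ⟨F₂, hF₂⟩ := 𝔅.exists_DMap ρ₂ ρ (LinearMap.inr P M₁ M₂) hι₂
  obtain ⟨G₁, hG₁⟩ := 𝔅.exists_DMap ρ ρ₁ (LinearMap.fst P M₁ M₂) hπ₁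
  obtain ⟨G₂, hG₂⟩ := 𝔅.exists_DMap ρ ρ₂ (LinearMap.snd P M₁ M₂) hπ₂
  -- `G_i ∘ F_j = δ_{ij}`
  have h11 : ∀ x, G₁ (F₁ x) = x := fun x => by
    apply Subtype.ext
    rw [hG₁, hF₁, ← LinearMap.comp_apply, ← AlgebraTensorModule.map_comp, LinearMap.id_comp,
      LinearMap.fst_comp_inl, AlgebraTensorModule.map_id, LinearMap.id_apply]
  have h22 : ∀ y, G₂ (F₂ y) = y := fun y => by
    apply Subtype.ext
    rw [hG₂, hF₂, ← LinearMap.comp_apply, ← AlgebraTensorModule.map_comp, LinearMap.id_comp,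
      LinearMap.snd_comp_inr, AlgebraTensorModule.map_id, LinearMap.id_apply]
  have h12 : ∀ y, G₁ (F₂ y) = 0 := fun y => by
    apply Subtype.ext
    rw [hG₁, hF₂, ← LinearMap.comp_apply, ← AlgebraTensorModule.map_comp, LinearMap.id_comp,
      LinearMap.fst_comp_inr, Submodule.coe_zero]
    exact 𝔅.algebraTensorModule_map_id_zero _
  have h21 : ∀ x, G₂ (F₁ x) = 0 := fun x => by
    apply Subtype.ext
    rw [hG₂, hF₁, ← LinearMap.comp_apply, ← AlgebraTensorModule.map_comp, LinearMap.id_comp,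
      LinearMap.snd_comp_inl, Submodule.coe_zero]
    exact 𝔅.algebraTensorModule_map_id_zero _
  have hinj : Function.Injective (F₁.coprod F₂) := by
    refine Function.LeftInverse.injective (g := fun z => (G₁ z, G₂ z)) fun xy => ?_
    obtain ⟨x, y⟩ := xy
    simp only [LinearMap.coprod_apply, map_add, h11, h12, h21, h22, add_zero, zero_add]
  calc Module.finrank E (𝔅.D ρ₁) + Module.finrank E (𝔅.D ρ₂)
      = Module.finrank E (𝔅.D ρ₁ × 𝔅.D ρ₂) := (Module.finrank_prod).symm
    _ ≤ Module.finrank E (𝔅.D ρ) := LinearMap.finrank_le_finrank_of_injective hinj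

/-- **`V₁ × V₂` is `B`-admissible iff `V₁` and `V₂` are** (Fontaine, Exposé III, Prop. 1.5.2:
direct sums and direct summands/quotients of admissible representations are admissible).  `⇒`:
the accepted `isAdmissible_of_shortExact` for `0 → V₁ → V₁ × V₂ → V₂ → 0`; `⇐`:
`finrank_D_add_le_finrank_D_prod` and Fontaine's inequality `dim D(V) ≤ dim V`
(`finrank_D_le_holds`). [cite: FontaineAsterisque223III, Exp. III §1.5, Prop. 1.5.2 and Prop. 1.4.2] -/
theorem isAdmissible_prod_iff [FiniteDimensional P M₁] [FiniteDimensional P M₂]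
    (h : ∀ (σ : Γ) (x : M₁ × M₂), ρ σ x = (ρ₁ σ x.1, ρ₂ σ x.2)) :
    𝔅.IsAdmissible ρ ↔ 𝔅.IsAdmissible ρ₁ ∧ 𝔅.IsAdmissible ρ₂ := by
  refine ⟨fun hρ => ?_, fun h₁₂ => ?_⟩
  · refine 𝔅.isAdmissible_of_shortExact ρ₁ ρ ρ₂ (LinearMap.inl P M₁ M₂) (LinearMap.snd P M₁ M₂)
      (fun σ x => by rw [h]; simp) (fun σ x => by rw [h]; rfl) LinearMap.inl_injective
      Prod.snd_surjective (fun x => ⟨fun hx => ⟨x.1, Prod.ext rfl ?_⟩, ?_⟩) hρ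
    · change (0 : M₂) = x.2
      exact (hx : x.2 = 0).symm
    · rintro ⟨a, rfl⟩
      rfl
  · obtain ⟨h₁, h₂⟩ := h₁₂
    have hle := 𝔅.finrank_D_add_le_finrank_D_prod ρ ρ₁ ρ₂ h
    have hD : Module.finrank E (𝔅.D ρ) ≤ Module.finrank P (M₁ × M₂) := 𝔅.finrank_D_le_holds ρ
    rw [IsAdmissible] at h₁ h₂ ⊢
    rw [Module.finrank_prod] at hD ⊢
    omega

end Prod

/-! ## §2 Framed form over a finite `E' ⊆ ℚ̄_p`: `S₁ ⊞ S₂` -/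

section Framed

set_option maxSynthPendingDepth 3

universe u v' w

variable {p : ℕ} [Fact p.Prime] {Γ : Type u} [Group Γ] [TopologicalSpace Γ]
  {E₁ : Type v'} [Field E₁] [Algebra ℚ_[p] E₁] (𝔅 : PeriodRingData.{u, 0, v', w} Γ ℚ_[p] E₁)

/-- **The `ℚ_p`-restriction of `S₁ ⊞ S₂` is `B`-admissible iff those of `S₁` and `S₂` are**
(`E'/ℚ_p` finite; framed `S₁ : Γ →ₜ* GL_m(E')`, `S₂ : Γ →ₜ* GL_n(E')`): concatenation along
`finSumFinEquiv` is an isomorphism of `ℚ_p[Γ]`-modules `E'^m × E'^n ≅ E'^{m+n}`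
(`isAdmissible_iff_of_equiv`), and `isAdmissible_prod_iff`.
[cite: FontaineAsterisque223III, Exp. III §1.5, Prop. 1.5.2] -/
theorem isAdmissible_restrictScalars_blockSum_iff
    {E' : IntermediateField ℚ_[p] (PadicAlgCl p)} [FiniteDimensional ℚ_[p] E'] {m n : ℕ}
    (S₁ : FramedRep Γ E' m) (S₂ : FramedRep Γ E' n) :
    𝔅.IsAdmissible (FramedRep.restrictScalars ℚ_[p] (S₁.blockSum S₂)) ↔
      𝔅.IsAdmissible (FramedRep.restrictScalars ℚ_[p] S₁) ∧
        𝔅.IsAdmissible (FramedRep.restrictScalars ℚ_[p] S₂) := by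
  classical
  obtain ⟨ρπ, hρπ⟩ :=
    ContinuousRep.exists_prod (FramedRep.restrictScalars ℚ_[p] S₁) (FramedRep.restrictScalars ℚ_[p] S₂)
  -- the `ℚ_p`-linear isomorphism `E'^m × E'^n ≃ E'^{m+n}` (concatenation along `finSumFinEquiv`)
  let Φ : ((Fin m → E') × (Fin n → E')) ≃ₗ[ℚ_[p]] (Fin (m + n) → E') :=
    { toFun := fun x j => Sum.elim x.1 x.2 (finSumFinEquiv.symm j)
      invFun := fun v => (fun i => v (Fin.castAdd n i), fun i => v (Fin.natAdd m i))
      map_add' := fun x y => by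
        funext j
        simp only [Prod.fst_add, Prod.snd_add, Pi.add_apply]
        cases finSumFinEquiv.symm j <;> simp
      map_smul' := fun c x => by
        funext j
        simp only [Prod.smul_fst, Prod.smul_snd, Pi.smul_apply, RingHom.id_apply]
        cases finSumFinEquiv.symm j <;> simp
      left_inv := fun x => by
        apply Prod.ext
        · funext i
          simp
        · funext i
          simp
      right_inv := fun v => by
        funext j
        obtain ⟨s, rfl⟩ := finSumFinEquiv.surjective j
        rcases s with i | i
        · simp
        · simp }
  have hΦx : ∀ x : (Fin m → E') × (Fin n → E'), (Φ x) ∘ finSumFinEquiv = Sum.elim x.1 x.2 := by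
    intro x
    funext s
    change Sum.elim x.1 x.2 (finSumFinEquiv.symm (finSumFinEquiv s)) = _
    rw [Equiv.symm_apply_apply]
  have hΦ : ∀ (σ : Γ) (x : (Fin m → E') × (Fin n → E')),
      Φ (ρπ σ x) = FramedRep.restrictScalars ℚ_[p] (S₁.blockSum S₂) σ (Φ x) := by
    intro σ x
    rw [FramedRep.restrictScalars_apply_apply, FramedRep.coe_blockSum_apply, blockSumRingHom_apply,
      Matrix.reindex_apply, Matrix.submatrix_mulVec_equiv, Equiv.symm_symm, hΦx,
      Matrix.fromBlocks_mulVec, Matrix.zero_mulVec, Matrix.zero_mulVec, add_zero, zero_add]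
    funext j
    obtain ⟨s, rfl⟩ := finSumFinEquiv.surjective j
    change Sum.elim (ρπ σ x).1 (ρπ σ x).2 (finSumFinEquiv.symm (finSumFinEquiv s)) = _
    rw [Equiv.symm_apply_apply, hρπ, Function.comp_apply, Equiv.symm_apply_apply]
    rcases s with i | i
    · simp
    · simp
  rw [← 𝔅.isAdmissible_iff_of_equiv ρπ _ Φ hΦ,
    𝔅.isAdmissible_prod_iff ρπ (FramedRep.restrictScalars ℚ_[p] S₁)
      (FramedRep.restrictScalars ℚ_[p] S₂) hρπ]

end Framed

end PeriodRingData

/-! ## §3 Over `ℚ̄_ℓ`: `ρ₁ ⊞ ρ₂` is de Rham iff `ρ₁` and `ρ₂` are -/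

section DeRham

variable {F : Type} [Field F] {ℓ : ℕ} [Fact ℓ.Prime]

-- Mathlib's own global value (nested instance problems on `𝔅.B ⊗[P] M`, see `PAdicHodgeProofs`).
set_option maxSynthPendingDepth 3 in
/-- **`ρ₁ ⊞ ρ₂` is de Rham iff `ρ₁` and `ρ₂` are, summands of any sizes** (Fontaine, Exposé III,
Prop. 1.5.2, for the accepted `FramedRep.IsDeRhamWith`; the equal-size case is
`FramedRep.isDeRhamWith_blockSum_iff`).  `⇒`: descend the frame of a finite model of `ρ₁ ⊞ ρ₂` to a
finite `E'` (`exists_conj_baseChange_eq_of_hasQlModel`); the entries of `ρ₁`, `ρ₂` then lie in `E'`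
(`blockSumRingHom_apply_castAdd_castAdd`, `…_natAdd_natAdd`), giving models `BE₁`, `BE₂` over `E'`
(`FramedRep.exists_baseChange_eq`) with `TE = BE₁ ⊞ BE₂` (`FramedRep.baseChange_blockSum`), and
`isAdmissible_restrictScalars_blockSum_iff` splits the admissibility.  `⇐`: models over `E'₁`,
`E'₂`, moved to the compositum, block-summed.
[cite: FontaineAsterisque223III, Exp. III §1.5, Prop. 1.5.2] [cite: BrinonConrad2009, Thm. 5.2.1]
[cite: BuzzardGeeLMS2014, §2.2] -/
theorem FramedRep.isDeRhamWith_blockSum_iff' (alg : Algebra ℚ_[ℓ] F)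
    (𝔅 : PeriodRingData.{0, 0, 0, 0} (absoluteGaloisGroup F) ℚ_[ℓ] F) {m n : ℕ}
    (ρ₁ : FramedRep (absoluteGaloisGroup F) (PadicAlgCl ℓ) m)
    (ρ₂ : FramedRep (absoluteGaloisGroup F) (PadicAlgCl ℓ) n) :
    (ρ₁.blockSum ρ₂).IsDeRhamWith alg 𝔅 ↔ ρ₁.IsDeRhamWith alg 𝔅 ∧ ρ₂.IsDeRhamWith alg 𝔅 := by
  letI := alg
  classical
  constructor
  · rintro ⟨E, hE, rE, hmodel, hadm⟩
    haveI := hE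
    obtain ⟨E', hEE', hE', Q, hTQ⟩ := exists_conj_baseChange_eq_of_hasQlModel hmodel
    haveI := hE'
    -- the descended model `TE` of `ρ₁ ⊞ ρ₂` over `E'`
    set TE : FramedRep (absoluteGaloisGroup F) E' (m + n) := FramedRep.conj Q
      (rE.baseChange (IntermediateField.inclusion hEE').toRingHom
        (continuous_intermediateField_inclusion hEE')) with hTEdef
    have hadmTE : 𝔅.IsAdmissible (FramedRep.restrictScalars ℚ_[ℓ] TE) := by
      rw [hTEdef, 𝔅.isAdmissible_restrictScalars_conj_iff,
        𝔅.isAdmissible_restrictScalars_baseChange_iff]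
      exact hadm
    -- entries of `ρ₁ ⊞ ρ₂`, hence of `ρ₁` and `ρ₂`, lie in `E'`
    have hTmem : ∀ g a b, (((ρ₁.blockSum ρ₂) g : GL (Fin (m + n)) (PadicAlgCl ℓ)) :
        Matrix (Fin (m + n)) (Fin (m + n)) (PadicAlgCl ℓ)) a b ∈ E' := fun g a b => by
      rw [← hTQ]
      exact TE.baseChange_apply_mem g a b
    have h₁T : ∀ g k l, ((ρ₁ g : GL (Fin m) (PadicAlgCl ℓ)) : Matrix (Fin m) (Fin m) (PadicAlgCl ℓ)) k l
        = (((ρ₁.blockSum ρ₂) g : GL (Fin (m + n)) (PadicAlgCl ℓ)) :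
          Matrix (Fin (m + n)) (Fin (m + n)) (PadicAlgCl ℓ)) (Fin.castAdd n k) (Fin.castAdd n l) :=
      fun g k l => by rw [FramedRep.coe_blockSum_apply, blockSumRingHom_apply_castAdd_castAdd]
    have h₂T : ∀ g k l, ((ρ₂ g : GL (Fin n) (PadicAlgCl ℓ)) : Matrix (Fin n) (Fin n) (PadicAlgCl ℓ)) k l
        = (((ρ₁.blockSum ρ₂) g : GL (Fin (m + n)) (PadicAlgCl ℓ)) :
          Matrix (Fin (m + n)) (Fin (m + n)) (PadicAlgCl ℓ)) (Fin.natAdd m k) (Fin.natAdd m l) :=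
      fun g k l => by rw [FramedRep.coe_blockSum_apply, blockSumRingHom_apply_natAdd_natAdd]
    have h₁mem : ∀ g k l, ((ρ₁ g : GL (Fin m) (PadicAlgCl ℓ)) :
        Matrix (Fin m) (Fin m) (PadicAlgCl ℓ)) k l ∈ E' ∧ (((ρ₁ g)⁻¹ : GL (Fin m) (PadicAlgCl ℓ)) :
          Matrix (Fin m) (Fin m) (PadicAlgCl ℓ)) k l ∈ E' := fun g k l =>
      ⟨by rw [h₁T]; exact hTmem g _ _, by rw [← map_inv, h₁T]; exact hTmem g⁻¹ _ _⟩
    have h₂mem : ∀ g k l, ((ρ₂ g : GL (Fin n) (PadicAlgCl ℓ)) :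
        Matrix (Fin n) (Fin n) (PadicAlgCl ℓ)) k l ∈ E' ∧ (((ρ₂ g)⁻¹ : GL (Fin n) (PadicAlgCl ℓ)) :
          Matrix (Fin n) (Fin n) (PadicAlgCl ℓ)) k l ∈ E' := fun g k l =>
      ⟨by rw [h₂T]; exact hTmem g _ _, by rw [← map_inv, h₂T]; exact hTmem g⁻¹ _ _⟩
    obtain ⟨BE₁, hBE₁⟩ := FramedRep.exists_baseChange_eq ρ₁ E' h₁mem
    obtain ⟨BE₂, hBE₂⟩ := FramedRep.exists_baseChange_eq ρ₂ E' h₂mem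
    -- `TE = BE₁ ⊞ BE₂` (both extend to `ρ₁ ⊞ ρ₂`, and `E' → ℚ̄_ℓ` is injective)
    have hTE : TE = BE₁.blockSum BE₂ := by
      refine ContinuousMonoidHom.ext fun g => Units.ext ?_
      apply Matrix.map_injective (algebraMap E' (PadicAlgCl ℓ)).injective
      change ((TE g : GL (Fin (m + n)) E') : Matrix (Fin (m + n)) (Fin (m + n)) E').map
          (algebraMap E' (PadicAlgCl ℓ)) =
        ((BE₁.blockSum BE₂ g : GL (Fin (m + n)) E') : Matrix (Fin (m + n)) (Fin (m + n)) E').map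
          (algebraMap E' (PadicAlgCl ℓ))
      rw [← FramedRep.coe_baseChange_apply (algebraMap E' (PadicAlgCl ℓ)) continuous_subtype_val TE g,
        ← FramedRep.coe_baseChange_apply (algebraMap E' (PadicAlgCl ℓ)) continuous_subtype_val
          (BE₁.blockSum BE₂) g, hTQ, FramedRep.baseChange_blockSum, hBE₁, hBE₂]
    rw [hTE] at hadmTE
    have hadm₁₂ := (𝔅.isAdmissible_restrictScalars_blockSum_iff BE₁ BE₂).1 hadmTE
    exact ⟨⟨E', hE', BE₁, ⟨1, by rw [hBE₁, FramedRep.conj_one_eq]⟩, hadm₁₂.1⟩,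
      ⟨E', hE', BE₂, ⟨1, by rw [hBE₂, FramedRep.conj_one_eq]⟩, hadm₁₂.2⟩⟩
  · rintro ⟨⟨E₁', hE₁', rE₁, hmodel₁, hadm₁⟩, ⟨E₂', hE₂', rE₂, hmodel₂, hadm₂⟩⟩
    haveI := hE₁'
    haveI := hE₂'
    obtain ⟨E₁'', h₁le, hE₁'', Q₁, hTQ₁⟩ := exists_conj_baseChange_eq_of_hasQlModel hmodel₁
    obtain ⟨E₂'', h₂le, hE₂'', Q₂, hTQ₂⟩ := exists_conj_baseChange_eq_of_hasQlModel hmodel₂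
    haveI := hE₁''
    haveI := hE₂''
    -- models `S₁`, `S₂` of `ρ₁`, `ρ₂` over `E₁''`, `E₂''`, admissible
    set S₁ : FramedRep (absoluteGaloisGroup F) E₁'' m := FramedRep.conj Q₁
      (rE₁.baseChange (IntermediateField.inclusion h₁le).toRingHom
        (continuous_intermediateField_inclusion h₁le)) with hS₁def
    set S₂ : FramedRep (absoluteGaloisGroup F) E₂'' n := FramedRep.conj Q₂
      (rE₂.baseChange (IntermediateField.inclusion h₂le).toRingHom
        (continuous_intermediateField_inclusion h₂le)) with hS₂def
    have hS₁adm : 𝔅.IsAdmissible (FramedRep.restrictScalars ℚ_[ℓ] S₁) := by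
      rw [hS₁def, 𝔅.isAdmissible_restrictScalars_conj_iff,
        𝔅.isAdmissible_restrictScalars_baseChange_iff]
      exact hadm₁
    have hS₂adm : 𝔅.IsAdmissible (FramedRep.restrictScalars ℚ_[ℓ] S₂) := by
      rw [hS₂def, 𝔅.isAdmissible_restrictScalars_conj_iff,
        𝔅.isAdmissible_restrictScalars_baseChange_iff]
      exact hadm₂
    -- move both to the compositum `E'' = E₁'' ⊔ E₂''`
    let E'' : IntermediateField ℚ_[ℓ] (PadicAlgCl ℓ) := E₁'' ⊔ E₂''
    haveI : FiniteDimensional ℚ_[ℓ] E'' := IntermediateField.finiteDimensional_sup E₁'' E₂''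
    let S₁' : FramedRep (absoluteGaloisGroup F) E'' m :=
      S₁.baseChange (IntermediateField.inclusion (le_sup_left : E₁'' ≤ E'')).toRingHom
        (continuous_intermediateField_inclusion le_sup_left)
    let S₂' : FramedRep (absoluteGaloisGroup F) E'' n :=
      S₂.baseChange (IntermediateField.inclusion (le_sup_right : E₂'' ≤ E'')).toRingHom
        (continuous_intermediateField_inclusion le_sup_right)
    have hS₁'B : S₁'.baseChange (algebraMap E'' (PadicAlgCl ℓ)) continuous_subtype_val = ρ₁ := by
      rw [← hTQ₁]
      exact ContinuousMonoidHom.ext fun g => Units.ext (Matrix.ext fun a b => rfl)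
    have hS₂'B : S₂'.baseChange (algebraMap E'' (PadicAlgCl ℓ)) continuous_subtype_val = ρ₂ := by
      rw [← hTQ₂]
      exact ContinuousMonoidHom.ext fun g => Units.ext (Matrix.ext fun a b => rfl)
    have hS₁'adm : 𝔅.IsAdmissible (FramedRep.restrictScalars ℚ_[ℓ] S₁') := by
      rw [𝔅.isAdmissible_restrictScalars_baseChange_iff]
      exact hS₁adm
    have hS₂'adm : 𝔅.IsAdmissible (FramedRep.restrictScalars ℚ_[ℓ] S₂') := by
      rw [𝔅.isAdmissible_restrictScalars_baseChange_iff]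
      exact hS₂adm
    -- the block sum of the models is a model of the block sum
    have hTB : (S₁'.blockSum S₂').baseChange (algebraMap E'' (PadicAlgCl ℓ)) continuous_subtype_val =
        ρ₁.blockSum ρ₂ := by
      rw [FramedRep.baseChange_blockSum, hS₁'B, hS₂'B]
    exact ⟨E'', inferInstance, S₁'.blockSum S₂', ⟨1, by rw [hTB, FramedRep.conj_one_eq]⟩,
      (𝔅.isAdmissible_restrictScalars_blockSum_iff S₁' S₂').2 ⟨hS₁'adm, hS₂'adm⟩⟩

/-- **`ρ₁ ⊞ ρ₂` is de Rham iff `ρ₁` and `ρ₂` are (any sizes), for a `p`-adic Hodge datum**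
(accepted `PstWeilDeligneData.IsDeRhamFramed`). [cite: FontaineAsterisque223III, Exp. III §1.5, Prop. 1.5.2] -/
theorem PstWeilDeligneData.isDeRhamFramed_blockSum_iff' [ValuativeRel F] [TopologicalSpace F]
    [IsNonarchimedeanLocalField F] (𝔇 : PstWeilDeligneData F ℓ) {m n : ℕ}
    (ρ₁ : FramedRep (absoluteGaloisGroup F) (PadicAlgCl ℓ) m)
    (ρ₂ : FramedRep (absoluteGaloisGroup F) (PadicAlgCl ℓ) n) :
    𝔇.IsDeRhamFramed (ρ₁.blockSum ρ₂) ↔ 𝔇.IsDeRhamFramed ρ₁ ∧ 𝔇.IsDeRhamFramed ρ₂ :=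
  FramedRep.isDeRhamWith_blockSum_iff' 𝔇.algebra 𝔇.𝔅 ρ₁ ρ₂

end DeRham

end Literature.NumberTheory.GaloisRepresentations

namespace Literature.NumberTheory.PAdicHodge

section Pinned

open NumberField IsDedekindDomain

variable {K : Type} [Field K] [NumberField K] {ℓ : ℕ} [Fact ℓ.Prime]

/-- **`ρ₁ ⊞ ρ₂` is de Rham at `v ∣ ℓ` iff `ρ₁` and `ρ₂` are (any sizes), for THE pinned Fontaine
data** of a number field `K` (`FramedGaloisRep.toLocal_blockSum`,
`PstWeilDeligneData.isDeRhamFramed_blockSum_iff'`). [cite: FontaineAsterisque223III, Exp. III §1.5, Prop. 1.5.2] -/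
theorem isDeRhamFramed_toLocal_blockSum_iff' {m n : ℕ} (ρ₁ : FramedGaloisRep K (PadicAlgCl ℓ) m)
    (ρ₂ : FramedGaloisRep K (PadicAlgCl ℓ) n) (v : HeightOneSpectrum (𝓞 K))
    (hv : ((ℓ : ℕ) : 𝓞 K) ∈ v.asIdeal) :
    (fontainePstAdicCompletion v ℓ hv).IsDeRhamFramed ((ρ₁.blockSum ρ₂).toLocal v) ↔
      (fontainePstAdicCompletion v ℓ hv).IsDeRhamFramed (ρ₁.toLocal v) ∧
        (fontainePstAdicCompletion v ℓ hv).IsDeRhamFramed (ρ₂.toLocal v) := by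
  rw [FramedGaloisRep.toLocal_blockSum]
  exact (fontainePstAdicCompletion v ℓ hv).isDeRhamFramed_blockSum_iff' (ρ₁.toLocal v) (ρ₂.toLocal v)

/-- Hence **`ρ₁ ⊞ ρ₂` is de Rham at every place above `ℓ` iff `ρ₁` and `ρ₂` are (any sizes).**
[cite: FontaineAsterisque223III, Exp. III §1.5, Prop. 1.5.2] -/
theorem forall_isDeRhamFramed_toLocal_blockSum_iff' {m n : ℕ}
    (ρ₁ : FramedGaloisRep K (PadicAlgCl ℓ) m) (ρ₂ : FramedGaloisRep K (PadicAlgCl ℓ) n) :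
    (∀ (v : HeightOneSpectrum (𝓞 K)) (hv : ((ℓ : ℕ) : 𝓞 K) ∈ v.asIdeal),
        (fontainePstAdicCompletion v ℓ hv).IsDeRhamFramed ((ρ₁.blockSum ρ₂).toLocal v)) ↔
      (∀ (v : HeightOneSpectrum (𝓞 K)) (hv : ((ℓ : ℕ) : 𝓞 K) ∈ v.asIdeal),
          (fontainePstAdicCompletion v ℓ hv).IsDeRhamFramed (ρ₁.toLocal v)) ∧
        ∀ (v : HeightOneSpectrum (𝓞 K)) (hv : ((ℓ : ℕ) : 𝓞 K) ∈ v.asIdeal),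
          (fontainePstAdicCompletion v ℓ hv).IsDeRhamFramed (ρ₂.toLocal v) := by
  simp only [isDeRhamFramed_toLocal_blockSum_iff']
  exact ⟨fun h => ⟨fun v hv => (h v hv).1, fun v hv => (h v hv).2⟩,
    fun h v hv => ⟨h.1 v hv, h.2 v hv⟩⟩

end Pinned

end Literature.NumberTheory.PAdicHodge

end
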